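/-
Copyright (c) 2026 the pub-hodgecm-mathlib formalisation cell (harness21).  Prover seat hodgecm-mathlib-K2E3-p03 (g10) on the S4 valve (dealer K2E2-plan (g8), S4-R59 (5)):
road (J̃♭) FILE (TJ5-win) = the WINDOW LETTERS `hwin₁ hwin₂ hν hA₀m` and the window subgroups `W j` of ★ (TJ5-abs) `twistedTubeJacobian_of_local`, in the chart frame.
Crux H413 `stmt-HodgeConjecture-24833`, lane `--supports … --as helper` (count-neutral).  THEOREMS ONLY (no `def`, no `instance`, no notation, no named-fact hypothesis, no `sorry`).
-/
import Summits.HodgeConjecture.HodgeConjecture.Theorems.F0P3cStCharTSJacCartanWindow   -- ★ C8b-window: `slice_window`, `image_mk_window`, `isOpen_window`, `measure_window_eq`, `quotientMeasure_window_ne` (brings ★ C8b-product, ★ (Q1))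
import HarnessLib

/-!
# R90-TF · S4 (Ch. 13.1–2) · road (J̃♭) «TWISTED TUBE JACOBIAN», FILE (TJ5-win): the chart windows as subgroups and the two window letters

Dealt by the S4 dealer K2E2-plan (g8) (S4-R59 (5), 03:04Z).  ★ (TJ5-abs) `R90S4TwistedTubeJacobianCore.twistedTubeJacobian_of_local` (p864907) assembles the localised
(J̃♭) letter from four local letters; THIS FILE pays the two WINDOW letters and the window data, in ★ C8b-window's ABSTRACT CHART FRAME
(`F0P3cStCharTSJacCartanWindow`: `ι Λ ρ c σV pM pT Ξ`, a subgroup `T ≤ G` linked to `ker pM` — at the datum `T := T̃ = Cent(γ₀)`) augmented by a closed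
subgroup `P′ ≤ T` (at the datum `T′ = G̃_{δε}`):
* §1 `exists_chartWindowSubgroups` — the chart windows `T ∩ c(Λ_j)` ARE compact open subgroups `W j ≤ T`, antitone in `j`, a neighbourhood basis of `1` (★ C8b-product
  `mul_mem_image_level` ∕ `chart_neg` ∕ `chart_zero` ∕ `exists_image_level_subset`) — the binders `W hWo hWc hWanti hWb` of (TJ5-abs).
* §2 `chartWindow_eq_transversal_mul` — ★ C8b-window's product window IS the product set: `c(Ξ(Λ′ₖ ∩ pT⁻¹Λ_j)) = c(pM Λ′ₖ) · (T ∩ c(Λ_j))` (★ `chart_product`).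
* §3 `hwin₂`: `ν(M₀ · (T ∩ c Λ_j)) = (ν∕tm)(π_T c(Λ′ₖ)) · tm(T ∩ c Λ_j)` (★ `measure_window_eq` through §2); `hν`: the window has positive finite `ν`-mass;
  `hwin₁`: `ν(M₀ · (T ∩ c Λ_j)) = (ν∕τ′)(π_{P′}(M₀ · (T ∩ c Λ_j))) · τ′(P′ ∩ c Λ_j)` (★ (Q1) slice lemma at `H := P′`, the `P′`-slices being read off ★ `slice_window`);
  `hA₀m`: `π_{P′}` of the window is Borel (open).
HONEST LABEL: HC_CM is proved only modulo the 7 printed citations (2 remaining named inputs: hLiu418 = `stmt-HodgeConjecture-24832`, h413 = `stmt-HodgeConjecture-24833`)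
until rung 0 closes; (J̃♭) OPEN; these are the `hwin₁ hwin₂ hν hA₀m`∕`W`-rows of the (J̃♭-Σ) assembly (K2E3-p31 (g3)), nothing else.

## References
* [HarishChandra1970] Harish-Chandra (notes by G. van Dijk), *Harmonic Analysis on Reductive p-adic Groups*, LNM 162 (1970), Lemma 22.
* [DeitmarEchterhoff2014] A. Deitmar, S. Echterhoff, *Principles of Harmonic Analysis*, 2nd ed. (2014), Thm. 1.5.3.
* [Serre1992LALG] J.-P. Serre, *Lie Algebras and Lie Groups*, LNM 1500 (1992), Part II Ch. IV §8–§9.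
* [Rogawski1990] J. Rogawski, *Automorphic Representations of Unitary Groups in Three Variables* (1990), §12.5 p. 186.
-/

set_option autoImplicit false
-- the mandated namespace repeats the single-problem summit's segment (`HodgeConjecture.HodgeConjecture`)
set_option linter.dupNamespace false

noncomputable section

open Set Filter MeasureTheory MeasureTheory.Measure TopologicalSpace Topology Matrix ValuativeRel
open Literature.NumberTheory.Automorphic Literature.NumberTheory.Weil1982.UnitaryFinTopForm Literature.MeasureTheory.Group
open Summit.HodgeConjecture.HodgeConjecture.Cruxes.H413.F0P3cStCharTSCayleyChartHaar
open Summit.HodgeConjecture.HodgeConjecture.Cruxes.H413.F0P3cStCharTSJacCartanProduct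
open Summit.HodgeConjecture.HodgeConjecture.Cruxes.H413.F0P3cStCharTSJacCartanWindow
open scoped Pointwise Topology ENNReal NNReal MatrixGroups

namespace Summit.HodgeConjecture.HodgeConjecture.R90.S4

section QuotientWindows

variable {K : Type*} [Field K] [ValuativeRel K] [TopologicalSpace K] [IsNonarchimedeanLocalField K]
  {m : Type*} [Fintype m] [DecidableEq m]
  {V : Type*} [AddCommGroup V] [TopologicalSpace V] [IsTopologicalAddGroup V] [T2Space V]
  {G : Type*} [Group G] [TopologicalSpace G] [IsTopologicalGroup G]
  (ι : V →+ Matrix m m K) (Λ : ℕ → AddSubgroup V) {α : ValueGroupWithZero K} (ρ : G →* GL m K) (c : V → G) (σV : V → V → V)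
  (pM pT : V →+ V) {Λ' : ℕ → AddSubgroup V} (Ξ : V → V) (T P' : Subgroup G) {k : ℕ}

/-! ## §1 The chart windows `T ∩ c(Λ_j)` as compact open subgroups of `T` -/

omit [IsTopologicalGroup G] in
/-- **THE CHART WINDOWS ARE SUBGROUPS**: for a closed `T ≤ G` there are subgroups `W j ≤ T` with `↑(W j) = {a ∈ T | a ∈ c(Λ_j)}`, each compact and open in `T`, antitone in `j`,
forming a neighbourhood basis of `1` in `T` (`c(Λ_j)` is closed under products and inverses by ★ C8b-product, open, compact; `c(Λ_j) → 1`).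
[cite: Serre1992LALG, Part II Ch. IV §8] [cite: HarishChandra1970, Lemma 22] -/
theorem exists_chartWindowSubgroups [T2Space G] (hTcl : IsClosed (T : Set G)) (hι : IsClosedEmbedding ι) (hΛ : ∀ j X, X ∈ Λ j ↔ ValBound (α ^ (j + 1)) (ι X))
    (hα : α ≠ 0) (hα1 : α < 1) (h2 : (2 : K) ≠ 0) (hρinj : Function.Injective ρ) (hc : ∀ X ∈ Λ 0, ((ρ (c X) : GL m K) : Matrix m m K) = cayley (ι X))
    (hcc : ContinuousOn c (Λ 0 : Set V)) (hK0 : IsOpen (c '' (Λ 0 : Set V)))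
    (hσ : ∀ W ∈ Λ 0, ∀ X ∈ Λ 0, ι (σV W X) = (1 - ι W)⁻¹ * (ι W + ι X) * (1 + ι W * ι X)⁻¹ * (1 - ι W))
    (hσc : ∀ W ∈ Λ 0, ContinuousOn (σV W) (Λ 0 : Set V)) :
    ∃ W : ℕ → Subgroup ↥T, (∀ j, (W j : Set ↥T) = {a : ↥T | (a : G) ∈ c '' (Λ j : Set V)}) ∧ (∀ j, IsOpen (W j : Set ↥T)) ∧ (∀ j, IsCompact (W j : Set ↥T)) ∧
      Antitone W ∧ ∀ O ∈ 𝓝 (1 : ↥T), ∃ j, (W j : Set ↥T) ⊆ O := by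
  have hanti := level_antitone ι Λ hΛ hα1.le
  have h0 := chart_zero ι Λ ρ c hρinj hc
  have hmul : ∀ {j : ℕ} {W X : V}, W ∈ Λ j → X ∈ Λ j → c W * c X ∈ c '' (Λ j : Set V) := fun hW hX =>
    mul_mem_image_level ι Λ ρ c σV hι hΛ hα hα1 h2 hρinj hc hσ hσc hW hX
  have hopen : ∀ j, IsOpen (c '' (Λ j : Set V)) := fun j =>
    isOpen_image_of_subset c hcc (injOn_chart ι Λ ρ c h2 hι.injective hΛ hα1 hc) (isCompact_level ι Λ hι hΛ 0) hK0 (isOpen_level ι Λ hι.continuous hΛ hα j)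
      (hanti (Nat.zero_le j))
  have hcomp : ∀ j, IsCompact (c '' (Λ j : Set V)) := fun j => (isCompact_level ι Λ hι hΛ j).image_of_continuousOn (hcc.mono (hanti (Nat.zero_le j)))
  have hS_mul : ∀ (j : ℕ) {a b : ↥T}, a ∈ {a : ↥T | (a : G) ∈ c '' (Λ j : Set V)} → b ∈ {a : ↥T | (a : G) ∈ c '' (Λ j : Set V)} →
      a * b ∈ {a : ↥T | (a : G) ∈ c '' (Λ j : Set V)} := by
    intro j a b ha hb
    obtain ⟨X, hX, hXa⟩ := ha
    obtain ⟨Y, hY, hYb⟩ := hb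
    show ((a * b : ↥T) : G) ∈ c '' (Λ j : Set V)
    rw [Subgroup.coe_mul, ← hXa, ← hYb]
    exact hmul hX hY
  have hS_inv : ∀ (j : ℕ) {a : ↥T}, a ∈ {a : ↥T | (a : G) ∈ c '' (Λ j : Set V)} → a⁻¹ ∈ {a : ↥T | (a : G) ∈ c '' (Λ j : Set V)} := by
    intro j a ha
    obtain ⟨X, hX, hXa⟩ := ha
    refine ⟨-X, neg_mem hX, ?_⟩
    rw [chart_neg ι Λ ρ c hΛ hα1 hρinj hc (hanti (Nat.zero_le j) hX), hXa, Subgroup.coe_inv]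
  refine ⟨fun j => { carrier := {a : ↥T | (a : G) ∈ c '' (Λ j : Set V)}, mul_mem' := hS_mul j, one_mem' := ⟨0, zero_mem _, h0⟩, inv_mem' := hS_inv j },
    fun j => rfl, fun j => (hopen j).preimage continuous_subtype_val, fun j => hTcl.isClosedEmbedding_subtypeVal.isCompact_preimage (hcomp j), ?_, ?_⟩
  · intro i j hij a ha
    obtain ⟨X, hX, hXa⟩ := ha
    exact ⟨X, hanti hij hX, hXa⟩
  · intro O hO
    rw [nhds_subtype, Filter.mem_comap] at hO
    obtain ⟨U, hU, hUO⟩ := hO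
    obtain ⟨j, hj⟩ := exists_image_level_subset Λ c (isOpen_level ι Λ hι.continuous hΛ hα) (exists_level_subset_of_mem_nhds ι Λ hι hΛ hα1) hcc h0 U
      (by simpa only [OneMemClass.coe_one] using hU)
    exact ⟨j, fun a ha => hUO (hj ha)⟩

/-! ## §2 The product window is a product set -/

omit [TopologicalSpace K] [IsNonarchimedeanLocalField K] [TopologicalSpace V] [IsTopologicalAddGroup V] [T2Space V] [TopologicalSpace G] [IsTopologicalGroup G] in
/-- **THE PRODUCT WINDOW IS THE PRODUCT SET `c(pM Λ′ₖ) · (T ∩ c Λ_j)`** (`j ≥ k`): `c(Ξ(Λ′ₖ ∩ pT⁻¹Λ_j)) = c(pM(Λ′ₖ)) · (c(Λ_j) ∩ T)` — `c(Ξ Z) = c(pM Z)·c(pT Z)` (★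
`chart_product`), `pT Z ∈ Λ_j ∩ ker pM`, and conversely `pM Z₀ + Y ∈ Λ′ₖ ∩ pT⁻¹Λ_j` for `Y ∈ Λ_j ∩ ker pM`. [cite: HarishChandra1970, Lemma 22] -/
theorem chartWindow_eq_transversal_mul (hΛ : ∀ j X, X ∈ Λ j ↔ ValBound (α ^ (j + 1)) (ι X)) (hα1 : α < 1) (hρinj : Function.Injective ρ)
    (hc : ∀ X ∈ Λ 0, ((ρ (c X) : GL m K) : Matrix m m K) = cayley (ι X))
    (hΛ' : ∀ j Z, Z ∈ Λ' j ↔ (pM Z ∈ Λ j ∧ pT Z ∈ Λ j)) (hsum : ∀ Z, pM Z + pT Z = Z) (hidem : ∀ Z, pM (pM Z) = pM Z)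
    (hΞ : ∀ Z ∈ Λ' k, ι (Ξ Z) = (1 - ι (pM Z))⁻¹ * (ι (pM Z) + ι (pT Z)) * (1 + ι (pM Z) * ι (pT Z))⁻¹ * (1 - ι (pM Z)))
    (hcT : ∀ Y ∈ Λ 0, pM Y = 0 → c Y ∈ T) (hTc : ∀ W ∈ Λ 0, c W ∈ T → pM W = 0) {j : ℕ} (hj : k ≤ j) :
    c '' (Ξ '' ((Λ' k : Set V) ∩ pT ⁻¹' (Λ j : Set V))) = c '' (pM '' (Λ' k : Set V)) * (c '' (Λ j : Set V) ∩ (T : Set G)) := by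
  have hanti := level_antitone ι Λ hΛ hα1.le
  have hk0 : Λ k ≤ Λ 0 := hanti (Nat.zero_le k)
  have hj0 : Λ j ≤ Λ 0 := hanti (Nat.zero_le j)
  have hjk : Λ j ≤ Λ k := hanti hj
  have hΞmem : ∀ Z ∈ Λ' k, Ξ Z ∈ Λ 0 := fun Z hZ => hk0 (product_mem_level ι Λ pM pT Ξ hΛ hα1 hΛ' hΞ hZ)
  have hΞc : ∀ Z ∈ Λ' k, c (Ξ Z) = c (pM Z) * c (pT Z) := fun Z hZ => chart_product ι Λ ρ c pM pT Ξ hΛ hα1 hρinj hc hΛ' hΞ hΞmem hZ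
  have hP := proj_ids pM pT hsum hidem
  ext g
  constructor
  · rintro ⟨_, ⟨Z, ⟨hZk, hZj⟩, rfl⟩, rfl⟩
    have hZj' : pT Z ∈ Λ j := hZj
    obtain ⟨hZM, hZT⟩ := (hΛ' k Z).1 hZk
    rw [hΞc Z hZk]
    exact Set.mul_mem_mul ⟨pM Z, ⟨Z, hZk, rfl⟩, rfl⟩ ⟨⟨pT Z, hZj', rfl⟩, hcT _ (hk0 hZT) (hP Z).2.1⟩
  · intro hg
    obtain ⟨x, ⟨_, ⟨Z₀, hZ₀, rfl⟩, rfl⟩, y, ⟨⟨Y, hY, rfl⟩, hYT⟩, rfl⟩ := Set.mem_mul.1 hg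
    have hZ₀' : Z₀ ∈ Λ' k := hZ₀
    obtain ⟨hZ₀M, -⟩ := (hΛ' k Z₀).1 hZ₀'
    have hY0 : pM Y = 0 := hTc Y (hj0 hY) hYT
    have hpM : pM (pM Z₀ + Y) = pM Z₀ := by rw [map_add, hidem, hY0, add_zero]
    have hpT : pT (pM Z₀ + Y) = Y := by rw [map_add, (hP Z₀).2.2.1, zero_add, (hP Y).2.2.2.2 hY0]
    have hZ : pM Z₀ + Y ∈ (Λ' k : Set V) ∩ pT ⁻¹' (Λ j : Set V) := by
      refine ⟨(hΛ' k _).2 ⟨by rw [hpM]; exact hZ₀M, by rw [hpT]; exact hjk hY⟩, ?_⟩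
      show pT (pM Z₀ + Y) ∈ (Λ j : Set V)
      rw [hpT]
      exact hY
    refine ⟨Ξ (pM Z₀ + Y), ⟨pM Z₀ + Y, hZ, rfl⟩, ?_⟩
    rw [hΞc _ hZ.1, hpM, hpT]

omit [TopologicalSpace V] [IsTopologicalAddGroup V] [T2Space V] [TopologicalSpace G] [IsTopologicalGroup G] in
/-- `c(Λ_j) ∩ T` is the underlying set of the chart window `{a ∈ T | a ∈ c(Λ_j)}`. [folklore] -/
theorem image_inter_coe_eq_image_val (j : ℕ) :
    c '' (Λ j : Set V) ∩ (T : Set G) = Subtype.val '' {a : ↥T | (a : G) ∈ c '' (Λ j : Set V)} := by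
  ext g
  constructor
  · rintro ⟨hg, hgT⟩
    exact ⟨⟨g, hgT⟩, hg, rfl⟩
  · rintro ⟨a, ha, rfl⟩
    exact ⟨ha, a.2⟩

/-! ## §3 The window letters `hwin₂`, `hν`, `hwin₁`, `hA₀m` of ★ (TJ5-abs) -/

variable [T2Space G] [LocallyCompactSpace G] [SecondCountableTopology G] [MeasurableSpace G] [BorelSpace G]
  (ν : Measure G) [ν.IsHaarMeasure] [ν.IsMulRightInvariant]

/-- **`hwin₂` — THE `T`-SLICED MASS OF THE WINDOW**: `ν(c(pM Λ′ₖ) · W_j) = (ν∕tm)(π_T c(Λ′ₖ)) · tm(W_j)` for the chart window `↑W_j = {a ∈ T | a ∈ c Λ_j}`, `j ≥ k`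
(★ `measure_window_eq` through `chartWindow_eq_transversal_mul`). [cite: DeitmarEchterhoff2014, Thm. 1.5.3] [cite: HarishChandra1970, Lemma 22] -/
theorem measure_transversal_mul_window_eq [MeasurableSpace (G ⧸ T)] [BorelSpace (G ⧸ T)]
    (tm : Measure ↥T) [tm.IsMulLeftInvariant] [IsFiniteMeasureOnCompacts tm] [tm.IsOpenPosMeasure] [tm.IsInvInvariant] [SFinite tm]
    (hTcl : IsClosed (T : Set G)) (hι : IsClosedEmbedding ι) (hΛ : ∀ j X, X ∈ Λ j ↔ ValBound (α ^ (j + 1)) (ι X)) (hα : α ≠ 0) (hα1 : α < 1)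
    (h2 : (2 : K) ≠ 0) (hρinj : Function.Injective ρ) (hc : ∀ X ∈ Λ 0, ((ρ (c X) : GL m K) : Matrix m m K) = cayley (ι X))
    (hcc : ContinuousOn c (Λ 0 : Set V)) (hK0 : IsOpen (c '' (Λ 0 : Set V)))
    (hσ : ∀ W ∈ Λ 0, ∀ X ∈ Λ 0, ι (σV W X) = (1 - ι W)⁻¹ * (ι W + ι X) * (1 + ι W * ι X)⁻¹ * (1 - ι W))
    (hσc : ∀ W ∈ Λ 0, ContinuousOn (σV W) (Λ 0 : Set V))
    (hΛ' : ∀ j Z, Z ∈ Λ' j ↔ (pM Z ∈ Λ j ∧ pT Z ∈ Λ j)) (hsum : ∀ Z, pM Z + pT Z = Z) (hidem : ∀ Z, pM (pM Z) = pM Z)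
    (hpMc : Continuous pM) (hpTc : Continuous pT) (hshift : ∀ j, ∀ Z ∈ Λ (j + k), pM Z ∈ Λ j ∧ pT Z ∈ Λ j)
    (hΞ : ∀ Z ∈ Λ' k, ι (Ξ Z) = (1 - ι (pM Z))⁻¹ * (ι (pM Z) + ι (pT Z)) * (1 + ι (pM Z) * ι (pT Z))⁻¹ * (1 - ι (pM Z)))
    (hcT : ∀ Y ∈ Λ 0, pM Y = 0 → c Y ∈ T) (hTc : ∀ W ∈ Λ 0, c W ∈ T → pM W = 0)
    {Wj : Subgroup ↥T} {j : ℕ} (hWj : (Wj : Set ↥T) = {a : ↥T | (a : G) ∈ c '' (Λ j : Set V)}) (hj : k ≤ j) :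
    ν (c '' (pM '' (Λ' k : Set V)) * Subtype.val '' (Wj : Set ↥T)) =
      quotientMeasure T tm hTcl ν ((QuotientGroup.mk : G → G ⧸ T) '' (c '' (Λ' k : Set V))) * tm Wj := by
  have hset : c '' (pM '' (Λ' k : Set V)) * Subtype.val '' (Wj : Set ↥T) = c '' (Ξ '' ((Λ' k : Set V) ∩ pT ⁻¹' (Λ j : Set V))) := by
    rw [hWj, ← image_inter_coe_eq_image_val, chartWindow_eq_transversal_mul ι Λ ρ c pM pT Ξ T hΛ hα1 hρinj hc hΛ' hsum hidem hΞ hcT hTc hj]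
  have hWj' : (Wj : Set ↥T) = {h : ↥T | (h : G) ∈ c '' (Λ j : Set V)} := hWj
  rw [hset, measure_window_eq ι Λ ρ c σV pM pT Ξ T ν tm hTcl hι hΛ hα hα1 h2 hρinj hc hcc hK0 hσ hσc hΛ' hsum hidem hpMc hpTc hshift hΞ hcT hTc hj, ← hWj']

omit [IsTopologicalGroup G] [LocallyCompactSpace G] [SecondCountableTopology G] [BorelSpace G] [ν.IsMulRightInvariant] in
/-- **`hν` — THE WINDOW HAS POSITIVE FINITE MASS**: `0 < ν(c(pM Λ′ₖ) · W_j) < ∞` (open, contains `1`; inside the compact `c(Λ 0)`). [cite: HarishChandra1970, Lemma 22] -/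
theorem measure_transversal_mul_window_ne (hι : IsClosedEmbedding ι) (hΛ : ∀ j X, X ∈ Λ j ↔ ValBound (α ^ (j + 1)) (ι X)) (hα : α ≠ 0) (hα1 : α < 1)
    (h2 : (2 : K) ≠ 0) (hρinj : Function.Injective ρ) (hc : ∀ X ∈ Λ 0, ((ρ (c X) : GL m K) : Matrix m m K) = cayley (ι X))
    (hcc : ContinuousOn c (Λ 0 : Set V)) (hK0 : IsOpen (c '' (Λ 0 : Set V)))
    (hΛ' : ∀ j Z, Z ∈ Λ' j ↔ (pM Z ∈ Λ j ∧ pT Z ∈ Λ j)) (hsum : ∀ Z, pM Z + pT Z = Z) (hidem : ∀ Z, pM (pM Z) = pM Z)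
    (hpMc : Continuous pM) (hpTc : Continuous pT) (hshift : ∀ j, ∀ Z ∈ Λ (j + k), pM Z ∈ Λ j ∧ pT Z ∈ Λ j)
    (hΞ : ∀ Z ∈ Λ' k, ι (Ξ Z) = (1 - ι (pM Z))⁻¹ * (ι (pM Z) + ι (pT Z)) * (1 + ι (pM Z) * ι (pT Z))⁻¹ * (1 - ι (pM Z)))
    (hcT : ∀ Y ∈ Λ 0, pM Y = 0 → c Y ∈ T) (hTc : ∀ W ∈ Λ 0, c W ∈ T → pM W = 0)
    {Wj : Subgroup ↥T} {j : ℕ} (hWj : (Wj : Set ↥T) = {a : ↥T | (a : G) ∈ c '' (Λ j : Set V)}) (hj : k ≤ j) :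
    ν (c '' (pM '' (Λ' k : Set V)) * Subtype.val '' (Wj : Set ↥T)) ≠ 0 ∧ ν (c '' (pM '' (Λ' k : Set V)) * Subtype.val '' (Wj : Set ↥T)) ≠ ⊤ := by
  have hanti := level_antitone ι Λ hΛ hα1.le
  have hset : c '' (pM '' (Λ' k : Set V)) * Subtype.val '' (Wj : Set ↥T) = c '' (Ξ '' ((Λ' k : Set V) ∩ pT ⁻¹' (Λ j : Set V))) := by
    rw [hWj, ← image_inter_coe_eq_image_val, chartWindow_eq_transversal_mul ι Λ ρ c pM pT Ξ T hΛ hα1 hρinj hc hΛ' hsum hidem hΞ hcT hTc hj]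
  rw [hset]
  have hopen := isOpen_window ι Λ ρ c pM pT Ξ hι hΛ hα hα1 h2 hc hcc hK0 hΛ' hsum hpMc hpTc hshift hΞ hj
  have h0mem : (0 : V) ∈ (Λ' k : Set V) ∩ pT ⁻¹' (Λ j : Set V) := ⟨zero_mem _, by show pT 0 ∈ (Λ j : Set V); rw [map_zero]; exact zero_mem _⟩
  have h1K : (1 : G) ∈ c '' (Ξ '' ((Λ' k : Set V) ∩ pT ⁻¹' (Λ j : Set V))) :=
    ⟨Ξ 0, ⟨0, h0mem, rfl⟩, by rw [product_zero ι pM pT Ξ hι.injective hΞ, chart_zero ι Λ ρ c hρinj hc]⟩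
  have hsub0 : c '' (Ξ '' ((Λ' k : Set V) ∩ pT ⁻¹' (Λ j : Set V))) ⊆ c '' (Λ 0 : Set V) := by
    rintro _ ⟨_, ⟨Z, hZ, rfl⟩, rfl⟩
    exact ⟨Ξ Z, hanti (Nat.zero_le k) (product_mem_level ι Λ pM pT Ξ hΛ hα1 hΛ' hΞ hZ.1), rfl⟩
  have hcomp0 : IsCompact (c '' (Λ 0 : Set V)) := (isCompact_level ι Λ hι hΛ 0).image_of_continuousOn hcc
  exact ⟨hopen.measure_ne_zero ν ⟨1, h1K⟩, (measure_mono hsub0 |>.trans_lt hcomp0.measure_lt_top).ne⟩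

omit [LocallyCompactSpace G] [SecondCountableTopology G] [MeasurableSpace G] [BorelSpace G] [ν.IsHaarMeasure] [ν.IsMulRightInvariant] in
/-- **`hA₀m` — the `P′`-class set of the window is Borel** (the window is open, `π_{P′}` is open). [cite: DeitmarEchterhoff2014, Thm. 1.5.3] -/
theorem measurableSet_image_mk_transversal_mul_window [MeasurableSpace (G ⧸ P')] [BorelSpace (G ⧸ P')]
    (hι : IsClosedEmbedding ι) (hΛ : ∀ j X, X ∈ Λ j ↔ ValBound (α ^ (j + 1)) (ι X)) (hα : α ≠ 0) (hα1 : α < 1)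
    (h2 : (2 : K) ≠ 0) (hρinj : Function.Injective ρ) (hc : ∀ X ∈ Λ 0, ((ρ (c X) : GL m K) : Matrix m m K) = cayley (ι X))
    (hcc : ContinuousOn c (Λ 0 : Set V)) (hK0 : IsOpen (c '' (Λ 0 : Set V)))
    (hΛ' : ∀ j Z, Z ∈ Λ' j ↔ (pM Z ∈ Λ j ∧ pT Z ∈ Λ j)) (hsum : ∀ Z, pM Z + pT Z = Z) (hidem : ∀ Z, pM (pM Z) = pM Z)
    (hpMc : Continuous pM) (hpTc : Continuous pT) (hshift : ∀ j, ∀ Z ∈ Λ (j + k), pM Z ∈ Λ j ∧ pT Z ∈ Λ j)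
    (hΞ : ∀ Z ∈ Λ' k, ι (Ξ Z) = (1 - ι (pM Z))⁻¹ * (ι (pM Z) + ι (pT Z)) * (1 + ι (pM Z) * ι (pT Z))⁻¹ * (1 - ι (pM Z)))
    (hcT : ∀ Y ∈ Λ 0, pM Y = 0 → c Y ∈ T) (hTc : ∀ W ∈ Λ 0, c W ∈ T → pM W = 0)
    {Wj : Subgroup ↥T} {j : ℕ} (hWj : (Wj : Set ↥T) = {a : ↥T | (a : G) ∈ c '' (Λ j : Set V)}) (hj : k ≤ j) :
    MeasurableSet ((QuotientGroup.mk : G → G ⧸ P') '' (c '' (pM '' (Λ' k : Set V)) * Subtype.val '' (Wj : Set ↥T))) := by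
  have hset : c '' (pM '' (Λ' k : Set V)) * Subtype.val '' (Wj : Set ↥T) = c '' (Ξ '' ((Λ' k : Set V) ∩ pT ⁻¹' (Λ j : Set V))) := by
    rw [hWj, ← image_inter_coe_eq_image_val, chartWindow_eq_transversal_mul ι Λ ρ c pM pT Ξ T hΛ hα1 hρinj hc hΛ' hsum hidem hΞ hcT hTc hj]
  rw [hset]
  exact measurableSet_image_mk_of_isOpen' P' (isOpen_window ι Λ ρ c pM pT Ξ hι hΛ hα hα1 h2 hc hcc hK0 hΛ' hsum hpMc hpTc hshift hΞ hj)

/-- **`hwin₁` — THE `P′`-SLICED MASS OF THE WINDOW** for a closed subgroup `P′ ≤ T`: `ν(c(pM Λ′ₖ) · W_j) = (ν∕τ′)(π_{P′}(c(pM Λ′ₖ) · W_j)) · τ′(P′ ∩ W_j)` — ★ (Q1)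
`measure_eq_quotientMeasure_image_mk_mul_of_slice` at `H := P′`, the `P′`-slice of the window through any of its points being `P′ ∩ c(Λ_j)` (★ `slice_window` read on
`P′ ≤ T`). [cite: DeitmarEchterhoff2014, Thm. 1.5.3] [cite: HarishChandra1970, Lemma 22] -/
theorem measure_transversal_mul_window_eq_quotient_mul [MeasurableSpace (G ⧸ P')] [BorelSpace (G ⧸ P')]
    (τ' : Measure ↥P') [τ'.IsMulLeftInvariant] [IsFiniteMeasureOnCompacts τ'] [τ'.IsOpenPosMeasure] [τ'.IsInvInvariant] [SFinite τ']
    (hP'cl : IsClosed (P' : Set G)) (hP'T : P' ≤ T) (hι : IsClosedEmbedding ι) (hΛ : ∀ j X, X ∈ Λ j ↔ ValBound (α ^ (j + 1)) (ι X)) (hα : α ≠ 0) (hα1 : α < 1)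
    (h2 : (2 : K) ≠ 0) (hρinj : Function.Injective ρ) (hc : ∀ X ∈ Λ 0, ((ρ (c X) : GL m K) : Matrix m m K) = cayley (ι X))
    (hcc : ContinuousOn c (Λ 0 : Set V)) (hK0 : IsOpen (c '' (Λ 0 : Set V)))
    (hσ : ∀ W ∈ Λ 0, ∀ X ∈ Λ 0, ι (σV W X) = (1 - ι W)⁻¹ * (ι W + ι X) * (1 + ι W * ι X)⁻¹ * (1 - ι W))
    (hσc : ∀ W ∈ Λ 0, ContinuousOn (σV W) (Λ 0 : Set V))
    (hΛ' : ∀ j Z, Z ∈ Λ' j ↔ (pM Z ∈ Λ j ∧ pT Z ∈ Λ j)) (hsum : ∀ Z, pM Z + pT Z = Z) (hidem : ∀ Z, pM (pM Z) = pM Z)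
    (hpMc : Continuous pM) (hpTc : Continuous pT) (hshift : ∀ j, ∀ Z ∈ Λ (j + k), pM Z ∈ Λ j ∧ pT Z ∈ Λ j)
    (hΞ : ∀ Z ∈ Λ' k, ι (Ξ Z) = (1 - ι (pM Z))⁻¹ * (ι (pM Z) + ι (pT Z)) * (1 + ι (pM Z) * ι (pT Z))⁻¹ * (1 - ι (pM Z)))
    (hcT : ∀ Y ∈ Λ 0, pM Y = 0 → c Y ∈ T) (hTc : ∀ W ∈ Λ 0, c W ∈ T → pM W = 0)
    {Wj : Subgroup ↥T} {j : ℕ} (hWj : (Wj : Set ↥T) = {a : ↥T | (a : G) ∈ c '' (Λ j : Set V)}) (hj : k ≤ j) :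
    ν (c '' (pM '' (Λ' k : Set V)) * Subtype.val '' (Wj : Set ↥T)) =
      quotientMeasure P' τ' hP'cl ν ((QuotientGroup.mk : G → G ⧸ P') '' (c '' (pM '' (Λ' k : Set V)) * Subtype.val '' (Wj : Set ↥T))) *
        τ' ((Subtype.val : ↥P' → G) ⁻¹' (Subtype.val '' (Wj : Set ↥T))) := by
  haveI : IsClosed (P' : Set G) := hP'cl
  have hanti := level_antitone ι Λ hΛ hα1.le
  have hset : c '' (pM '' (Λ' k : Set V)) * Subtype.val '' (Wj : Set ↥T) = c '' (Ξ '' ((Λ' k : Set V) ∩ pT ⁻¹' (Λ j : Set V))) := by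
    rw [hWj, ← image_inter_coe_eq_image_val, chartWindow_eq_transversal_mul ι Λ ρ c pM pT Ξ T hΛ hα1 hρinj hc hΛ' hsum hidem hΞ hcT hTc hj]
  have hopen := isOpen_window ι Λ ρ c pM pT Ξ hι hΛ hα hα1 h2 hc hcc hK0 hΛ' hsum hpMc hpTc hshift hΞ hj
  -- the `P′`-slice set `P′ ∩ c(Λ_j)` and its two descriptions
  have hT₀eq : (Subtype.val : ↥P' → G) ⁻¹' (Subtype.val '' (Wj : Set ↥T)) = {p : ↥P' | (p : G) ∈ c '' (Λ j : Set V)} := by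
    rw [hWj, ← image_inter_coe_eq_image_val]
    ext p
    simp only [mem_preimage, mem_inter_iff, SetLike.mem_coe, mem_setOf_eq]
    exact ⟨fun h => h.1, fun h => ⟨h, hP'T p.2⟩⟩
  have hopenj : IsOpen (c '' (Λ j : Set V)) :=
    isOpen_image_of_subset c hcc (injOn_chart ι Λ ρ c h2 hι.injective hΛ hα1 hc) (isCompact_level ι Λ hι hΛ 0) hK0 (isOpen_level ι Λ hι.continuous hΛ hα j)
      (hanti (Nat.zero_le j))
  have hT₀m : MeasurableSet {p : ↥P' | (p : G) ∈ c '' (Λ j : Set V)} := (hopenj.preimage continuous_subtype_val).measurableSet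
  have hslice : ∀ x ∈ c '' (Ξ '' ((Λ' k : Set V) ∩ pT ⁻¹' (Λ j : Set V))),
      {p : ↥P' | x * (p : G) ∈ c '' (Ξ '' ((Λ' k : Set V) ∩ pT ⁻¹' (Λ j : Set V)))} = {p : ↥P' | (p : G) ∈ c '' (Λ j : Set V)} := by
    intro x hx
    have hT := slice_window ι Λ ρ c σV pM pT Ξ T hι hΛ hα hα1 h2 hρinj hc hσ hσc hΛ' hsum hidem hshift hΞ hcT hTc hj hx
    ext p
    have hp := Set.ext_iff.1 hT ⟨(p : G), hP'T p.2⟩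
    simp only [mem_setOf_eq] at hp ⊢
    exact hp
  rw [hset, hT₀eq]
  exact measure_eq_quotientMeasure_image_mk_mul_of_slice P' τ' ν hopen.measurableSet (measurableSet_image_mk_of_isOpen' P' hopen) hT₀m hslice

end QuotientWindows

end Summit.HodgeConjecture.HodgeConjecture.R90.S4

end
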